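import Literature.Barriers.ValiantsHypothesis.KroneckerXRayCodes
import Literature.Computability.Complexity.XRayMachineLists
import HarnessLib

/-!
# The simplex embedding `2D-X-RAY → KRONECKER` on codes, I: total decoding and the code test

First machine file towards the named fact `FischerIkenmeyer2020_xrayToKronecker_mem_FP :
xrayToKronecker ∈ FP` (`KroneckerPositivityHardnessProofs.lean`). The map `xrayToKronecker`
sends a word that is the code (`encodingTwoDXRay`: `⟨code μ', ⟨code ν', code ρ'⟩⟩`, each list in
unary, `encodeUnaryList_eq`) of an admissible 2D-X-RAY instance to the unary Kronecker code of its
simplex embedding and every other word to `noCode`; so its machine must first decide "`w` is a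
code". This file supplies, as brick algebra:

* the **total reading** of a unary list code `z = ⟨h, ⟨u₀, ⟨u₁, …⟩⟩⟩`: `n = |h|` items, item `i`
  read as the number `|uᵢ|` (`itemOf`, `decUL`; `decUL (code l) = l`), and of a word as a triple
  (`decTriple`; `decTriple (encode I) = I`);
* the **re-encoding brick** `reencL` (an indexed fold writing `frame 1^{|uᵢ|}` for `i < |h|`,
  value `reencL z = code (decUL z)` on EVERY string) and `reencF w = encode (decTriple w)`;
* the **code test** `canonXF w = [encode (decTriple w) = w]` (one-bit, in `FP`) with
  `exists_encode_iff : (∃ I, encode I = w) ↔ encode (decTriple w) = w`.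

## References

* [AroraBarak2009] S. Arora, B. Barak, *Computational Complexity*, CUP 2009, §1.3, §0.1.
* [FischerIkenmeyer2020] N. Fischer, C. Ikenmeyer, Comput. Complexity 29 (2020) 8, §3 (unary
  inputs), §6 (Problem 5), Thm. 5.
-/

noncomputable section

namespace Literature.Barriers.ValiantsHypothesis

namespace XRayKron

open _root_.Computability Polynomial Literature.Computability.Complexity Literature.Computability.Complexity.Brick
  Literature.Computability.Complexity.Ladder3 Literature.Computability.Complexity.HashBricks
  Literature.Computability.Complexity.OneInThree

/-! ### Total reading of unary list codes -/

/-- Item `i` of a list code `z = ⟨h, items⟩` (junk past the end). [folklore] -/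
def itemOf (z : List Bool) (i : ℕ) : List Bool := fstF (sndF^[i] (sndF z))

/-- **The total reading of a unary list code**: `|h|` items, item `i` read as `|uᵢ|`. [folklore] -/
def decUL (z : List Bool) : List ℕ := (List.range (fstF z).length).map fun i => (itemOf z i).length

/-- The total reading of a word as a 2D-X-RAY instance `(μ', ν', ρ')`. [folklore] -/
def decTriple (w : List Bool) : List ℕ × List ℕ × List ℕ :=
  (decUL (fstF w), decUL (fstF (sndF w)), decUL (sndF (sndF w)))

/-- Length of the reading. [folklore] -/
@[simp] theorem length_decUL (z : List Bool) : (decUL z).length = (fstF z).length := by simp [decUL]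

/-- Items are substrings: `|itemOf z i| ≤ |z|`. [folklore] -/
theorem length_itemOf_le (z : List Bool) (i : ℕ) : (itemOf z i).length ≤ z.length :=
  (Lemma3FP.length_fstF_le _).trans ((length_iterate_sndF_le _ _).trans (Lemma3FP.length_sndF_le z))

/-- Items of a genuine list code. [folklore] -/
theorem itemOf_code (l : List ℕ) {i : ℕ} (hi : i < l.length) :
    itemOf (encodingUnaryListNat.encode l) i = ones (l[i]) := by
  have : ∀ (j : ℕ) (zz : List Bool), fstF (sndF^[j] zz) = nthF j zz := by
    intro j; induction j with
    | zero => intro zz; rfl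
    | succ j ih => intro zz; rw [Function.iterate_succ_apply, ih]; rfl
  rw [itemOf, encodeUnaryList_eq, sndF_boolPair, this, nthF_encList, List.getD_eq_getElem _ _ (by simpa using hi),
    List.getElem_map]

/-- **The reading inverts the encoding of unary lists.** [folklore] -/
theorem decUL_code (l : List ℕ) : decUL (encodingUnaryListNat.encode l) = l := by
  apply List.ext_getElem
  · rw [length_decUL, encodeUnaryList_eq, fstF_boolPair, List.length_replicate]
  · intro i h1 h2
    rw [length_decUL, encodeUnaryList_eq, fstF_boolPair, List.length_replicate] at h1
    simp only [decUL, List.getElem_map, List.getElem_range, itemOf_code l h1, List.length_replicate]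

/-- **The reading inverts the encoding of instances.** [folklore] -/
theorem decTriple_encode (I : List ℕ × List ℕ × List ℕ) : decTriple (encodingTwoDXRay.encode I) = I := by
  obtain ⟨a, b, c⟩ := I
  simp only [decTriple, encodingTwoDXRay, Computability.Encoding.pairBool, fstF_boolPair, sndF_boolPair, decUL_code]

/-- **Codes are the fixed points of re-encoding the reading.** [folklore] -/
theorem exists_encode_iff (w : List Bool) :
    (∃ I : List ℕ × List ℕ × List ℕ, encodingTwoDXRay.encode I = w) ↔ encodingTwoDXRay.encode (decTriple w) = w := by
  constructor
  · rintro ⟨I, rfl⟩; rw [decTriple_encode]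
  · intro h; exact ⟨_, h⟩

/-! ### The re-encoding brick -/

/-- On `⟨z, 1ⁱ⟩`: the framed normalised item `frame 1^{|uᵢ|}`. [folklore] -/
def itemPiece : List Bool → List Bool := frameF (onesFn ∘ nthItemFn ∘ fanoutFn sndF (sndF ∘ fstF))

/-- The initial record `⟨z, ⟨bin |h|, ⟨1⁰, ε⟩⟩⟩`. [folklore] -/
def reInit : List Bool → List Bool := fanoutFn id (fanoutFn (lenBinF ∘ fstF) (fun _ => boolPair (ones 0) []))

/-- **Re-encoding a unary list code**: `⟨1^{|h|}, frame 1^{|u₀|} ⋯ frame 1^{|u_{|h|-1}|}⟩`. [folklore] -/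
def reencL : List Bool → List Bool :=
  fanoutFn (onesFn ∘ fstF) (sndPow 2 ∘ foldLoop appF (clipF 3 itemPiece) X ∘ reInit)

/-- **Re-encoding a word as an instance code.** [folklore] -/
def reencF : List Bool → List Bool :=
  fanoutFn (reencL ∘ fstF) (fanoutFn (reencL ∘ fstF ∘ sndF) (reencL ∘ sndF ∘ sndF))

/-- **The code test**: `[re-encoding of the reading = the input]`. [folklore] -/
def canonXF : List Bool → List Bool := eqPairFn ∘ fanoutFn reencF id

/-- `itemPiece ∈ FP`. [cite: AroraBarak2009, §1.3] -/
theorem itemPiece_mem_FP : itemPiece ∈ FP :=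
  frameF_mem_FP (comp_mem_FP onesFn_mem_FP (comp_mem_FP nthItemFn_mem_FP
    (fanoutFn_mem_FP sndF_mem_FP (comp_mem_FP sndF_mem_FP fstF_mem_FP))))

/-- `reInit ∈ FP`. [cite: AroraBarak2009, §1.3] -/
theorem reInit_mem_FP : reInit ∈ FP :=
  fanoutFn_mem_FP (PolyTimeComputable.id _) (fanoutFn_mem_FP (comp_mem_FP lenBinF_mem_FP fstF_mem_FP) (const_mem_FP _))

/-- **`reencL ∈ FP`.** [cite: AroraBarak2009, §1.3 (bounded loops)] -/
theorem reencL_mem_FP : reencL ∈ FP :=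
  fanoutFn_mem_FP (comp_mem_FP onesFn_mem_FP fstF_mem_FP) (comp_mem_FP (sndPow_mem_FP 2) (comp_mem_FP
    (foldLoop_clipF_mem_FP 3 appF_mem_FP length_appF_le itemPiece_mem_FP _) reInit_mem_FP))

/-- **`reencF ∈ FP`.** [cite: AroraBarak2009, §1.3] -/
theorem reencF_mem_FP : reencF ∈ FP :=
  fanoutFn_mem_FP (comp_mem_FP reencL_mem_FP fstF_mem_FP) (fanoutFn_mem_FP
    (comp_mem_FP reencL_mem_FP (comp_mem_FP fstF_mem_FP sndF_mem_FP))
    (comp_mem_FP reencL_mem_FP (comp_mem_FP sndF_mem_FP sndF_mem_FP)))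

/-- **`canonXF ∈ FP`.** [cite: AroraBarak2009, §1.3] -/
theorem canonXF_mem_FP : canonXF ∈ FP := comp_mem_FP eqPairFn_mem_FP (fanoutFn_mem_FP reencF_mem_FP (PolyTimeComputable.id _))

/-- The code test is one-bit. [folklore] -/
theorem oneBit_canonXF : OneBit canonXF := oneBit_eqPairFn.comp _

/-- Value of the item piece on `⟨z, 1ⁱ⟩` (any `z`). [folklore] -/
theorem itemPiece_boolPair (z : List Bool) (i : ℕ) :
    itemPiece (boolPair z (ones i)) = Ladder3.frame (ones (itemOf z i).length) := by
  simp only [itemPiece, frameF_apply, Function.comp_apply, fanoutFn_apply, sndF_boolPair, fstF_boolPair,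
    nthItemFn_boolPair, List.length_replicate, onesFn, unaryEncodeNat_eq_ones', itemOf]

/-- **Value of the re-encoding on every string**: the code of the reading. [folklore] -/
theorem reencL_apply (z : List Bool) : reencL z = encodingUnaryListNat.encode (decUL z) := by
  obtain ⟨K, hK⟩ : ∃ K, (fstF z).length = K := ⟨_, rfl⟩
  have hinit : reInit z = boolPair z (boolPair (encodeNat K) (boolPair (ones 0) [])) := by
    simp only [reInit, fanoutFn_apply, id, Function.comp_apply, lenBinF_apply, hK]
  have hk : K ≤ X.eval z.length := by rw [eval_X, ← hK]; exact Lemma3FP.length_fstF_le z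
  rw [reencL, fanoutFn_apply, Function.comp_apply, Function.comp_apply, Function.comp_apply, hinit,
    foldLoop_apply _ _ hk, foldAcc_clipF, foldAcc_appF, List.nil_append, encodeUnaryList_eq, length_decUL, hK, onesFn,
    unaryEncodeNat_eq_ones']
  · simp only [sndPow_succ_boolPair, sndPow_zero_boolPair, Nat.zero_add]
    rw [ccat_frame (fun i => (itemOf z i).length) z (itemPiece_boolPair z) K, decUL, hK, List.map_map]
  · intro j _ _
    rw [itemPiece_boolPair, length_frame, List.length_replicate]
    have := length_itemOf_le z j; omega

/-- **Value of the word re-encoding**: `encode (decTriple w)`. [folklore] -/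
theorem reencF_apply (w : List Bool) : reencF w = encodingTwoDXRay.encode (decTriple w) := by
  simp only [reencF, fanoutFn_apply, Function.comp_apply, reencL_apply, decTriple]
  rfl

/-- **Value of the code test**: `[encode (decTriple w) = w]`. [folklore] -/
theorem canonXF_apply (w : List Bool) : canonXF w = [decide (encodingTwoDXRay.encode (decTriple w) = w)] := by
  rw [canonXF, Function.comp_apply, fanoutFn_apply, reencF_apply, id, eqPairFn_boolPair]

/-- The code test is true exactly on codes. [folklore] -/
theorem canonXF_eq_true_iff (w : List Bool) :
    canonXF w = [true] ↔ ∃ I : List ℕ × List ℕ × List ℕ, encodingTwoDXRay.encode I = w := by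
  rw [canonXF_apply, exists_encode_iff]; simp

end XRayKron

end Literature.Barriers.ValiantsHypothesis
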